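import Literature.NumberTheory.GaloisRepresentations.HeckeCharacterConductorExponentProofs
import Literature.NumberTheory.GaloisRepresentations.HeckeCharacterDictionary
import Literature.NumberTheory.GaloisRepresentations.AlgebraicHeckeCharacterGrossencharakterProofs
import Literature.NumberTheory.GaloisRepresentations.GrossencharakterIdeleValue
import HarnessLib

/-!
# The SHARP module of definition of an algebraic Hecke character: the conductor is a module of definition, and the
# ideal character is a Größencharakter modulo `∏_{v∈T} 𝔭_v^{e_v}` itself (no `+1` slack) — proofs

Topic `NumberTheory/GaloisRepresentations`; namespace `Literature.NumberTheory.GaloisRepresentations.HeckeCharacter`.  THEOREMS ONLY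
(no definition, no named fact, no instance, no `sorry`).  Companion of `HeckeCharacterConductorExponentProofs.lean` (the conductor
exponent `f(χ_v)` exists and is attained) and `AlgebraicHeckeCharacterGrossencharakterProofs.lean`, whose ray relation
`HasInfinityType.idealPow_span_eq` is stated modulo `modulusIdeal T e = ∏_{v∈T} 𝔭_v^{e_v+1}` — ONE exponent more than the module of
definition `(T, e)` kills.  For the PRIMITIVE Größencharakter attached to a datum (its theta series is a newform only at the exact conductor
level, Shimura / Miyake Thm. 4.8.2) the relation is needed modulo `∏_{v∈T} 𝔭_v^{e_v}` with all `e_v ≥ 1`; this file proves it, by the same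
decomposition of principal ideles (Neukirch VII (6.13), the tree's `map_principalIdele_eq`).

* §1 the ideal `∏_{v∈T} 𝔭_v^{e_v}` with `e ≥ 1` on `T`: non-zero, support exactly `T`, `𝔭_v^{e_v}` divides it.
* §2 `IsModulus.isTrivialOnHigherUnitsAt` — a module of definition `(T, e)` trivialises `U_v^{(e_v)}` (`v ∈ T`);
  `IsModulus.of_isTrivialOnHigherUnitsAt` — **lowering the exponents** of a module of definition to any place-wise trivialising family;
  ★ `isModulus_conductorExponentAt` — **the conductor `(ram χ, f(χ_·))` is a module of definition** (Neukirch VII §6, after (6.11)).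
* §3 ★★ `HasInfinityType.idealPow_span_eq_sharp` — for `χ` of type `(p, q)` with module of definition `(T, e)`, `e ≥ 1` on `T`, and
  non-zero integers `b ≡ c mod ∏_{v∈T} 𝔭_v^{e_v}`, `c` prime to `T`, `b/c ≫ 0`: `χ̃((b)) = χ̃((c))·∏_w σ_w(b/c)^{p_w} σ̄_w(b/c)^{q_w}`;
  `isGrossencharakter_valueAtUniformizer_sharp` — so `v ↦ χ(ϖ_v)` IS a Größencharakter modulo `∏_{v∈T} 𝔭_v^{e_v}`.

References: [NeukirchANT1999] Ch. VII §6 Def. (6.1), (6.10)–(6.11), Prop. (6.13), Cor. (6.14); [TateThesis1967] §2.3; [Weil1956] §1.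
Filed for the de-cite of Ribet's bad Euler factors in crux L `SmallImageLowerHalfBothSigns` of `Summits/BirchSwinnertonDyer`; nothing about
BSD is proved here.  (A Summit-side special case of §3 for `a ≡ 1` exists: `Summit.BirchSwinnertonDyer.Rank1Residual.Additive.RamifiedSevenGenusConductorBridge`.)

## Mathlib / tree search
Tree: `HeckeCharacter.IsModulus`, `map_principalIdele_eq`, `map_prod_localUnits_eq_one_of_isModulus`, `isUnramifiedAt_of_isModulus'`,
`snd_prod_localUnits`, `fst_prod_localUnits` (`HeckeCharacterDictionary` / `HeckeCharacterProofs`); `exists_isModulus_of_ramified`,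
`HasInfinityType.apply_globalToInfiniteUnits_eq`, `IsUnramifiedAt.coe_map_localUnits_eq_zpow` (`AlgebraicHeckeCharacterGrossencharakterProofs`);
`isTrivialOnHigherUnitsAt_conductorExponentAt`, `conductorExponentAt_eq_zero_iff` (`HeckeCharacterConductorExponentProofs`).
Mathlib: `Ideal.IsPrime.prod_le`, `Ideal.IsPrime.pow_le_iff`, `Finset.dvd_prod_of_mem`, `HeightOneSpectrum.intValuation_le_pow_iff_mem`.
`lean search 'idealPow_span_eq_sharp|isModulus_conductor|of_isTrivialOnHigherUnitsAt'` (2026-08-31): only the Summit-side special case above.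
-/

noncomputable section

open scoped NumberField ComplexConjugate Classical
open NumberField IsDedekindDomain Filter

namespace Literature.NumberTheory.GaloisRepresentations

universe u

variable {K : Type u} [Field K] [NumberField K]

namespace HeckeCharacter

/-! ### §1 The ideal `∏_{v∈T} 𝔭_v^{e_v}` -/

omit [NumberField K] in
/-- `∏_{v∈T} 𝔭_v^{e_v} ≠ 0`. [cite: NeukirchANT1999, Ch. I §3 (3.3)] -/
theorem prod_pow_asIdeal_ne_bot (T : Finset (HeightOneSpectrum (𝓞 K))) (e : HeightOneSpectrum (𝓞 K) → ℕ) :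
    (∏ v ∈ T, v.asIdeal ^ e v : Ideal (𝓞 K)) ≠ ⊥ := by
  intro h
  have hne : (∏ v ∈ T, v.asIdeal ^ e v : Ideal (𝓞 K)) ≠ 0 :=
    Finset.prod_ne_zero_iff.mpr fun v _ => pow_ne_zero _ v.ne_bot
  exact hne (h.trans Submodule.zero_eq_bot.symm)

/-- With all exponents `e_v ≥ 1` on `T`, the primes of `∏_{v∈T} 𝔭_v^{e_v}` are exactly those of `T`. [cite: NeukirchANT1999, Ch. I §3 (3.3)] -/
theorem prod_pow_asIdeal_le_iff {T : Finset (HeightOneSpectrum (𝓞 K))} {e : HeightOneSpectrum (𝓞 K) → ℕ}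
    (he : ∀ v ∈ T, 0 < e v) {w : HeightOneSpectrum (𝓞 K)} :
    (∏ v ∈ T, v.asIdeal ^ e v : Ideal (𝓞 K)) ≤ w.asIdeal ↔ w ∈ T := by
  rw [Ideal.IsPrime.prod_le w.isPrime]
  constructor
  · rintro ⟨v, hv, hvw⟩
    have hvw' : v.asIdeal ≤ w.asIdeal := (Ideal.IsPrime.pow_le_iff (he v hv).ne').mp hvw
    have : v = w := HeightOneSpectrum.ext (v.isMaximal.eq_of_le w.isPrime.ne_top hvw')
    exact this ▸ hv
  · intro hw
    exact ⟨w, hw, Ideal.pow_le_self (he w hw).ne'⟩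

omit [NumberField K] in
/-- `𝔭_v^{e_v} ∣ ∏_{w∈T} 𝔭_w^{e_w}` for `v ∈ T`. [cite: NeukirchANT1999, Ch. I §3 (3.3)] -/
theorem pow_dvd_prod_pow_asIdeal {T : Finset (HeightOneSpectrum (𝓞 K))} (e : HeightOneSpectrum (𝓞 K) → ℕ)
    {v : HeightOneSpectrum (𝓞 K)} (hv : v ∈ T) : v.asIdeal ^ e v ∣ ∏ w ∈ T, w.asIdeal ^ e w :=
  Finset.dvd_prod_of_mem (fun w => w.asIdeal ^ e w) hv

/-! ### §2 Lowering the exponents of a module of definition; the conductor is a module of definition -/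

/-- **A module of definition `(T, e)` of `χ` makes `χ_v` trivial on `U_v^{(e_v)}` for `v ∈ T`**: the idele `⟨u⟩_v`
(`u ∈ 𝒪_vˣ`, `u ≡ 1 mod 𝔭_v^{e_v}`) has `x_∞ = 1`, unit components, and satisfies the congruences of `(T, e)`.
[cite: NeukirchANT1999, Ch. VII §6 (6.10)–(6.11)] -/
theorem IsModulus.isTrivialOnHigherUnitsAt {χ : HeckeCharacter K} {T : Finset (HeightOneSpectrum (𝓞 K))}
    {e : HeightOneSpectrum (𝓞 K) → ℕ} (hmod : χ.IsModulus T e) {v : HeightOneSpectrum (𝓞 K)} (hv : v ∈ T) :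
    χ.IsTrivialOnHigherUnitsAt v (e v) := by
  intro u hu
  rw [localComponent_apply]
  refine hmod _ (localUnits_fst v _) (fun w => ?_) (fun w hw => ?_)
  · by_cases hwv : w = v
    · subst hwv
      rw [localUnits_snd_apply_self]
      exact HeightOneSpectrum.adicCompletionIntegers.isUnit_iff_valued_eq_one.1 u.isUnit
    · rw [localUnits_snd_apply_of_ne _ hwv, map_one]
  · by_cases hwv : w = v
    · subst hwv
      rw [localUnits_snd_apply_self]
      exact hu
    · rw [localUnits_snd_apply_of_ne _ hwv, sub_self, map_zero]
      exact zero_le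

/-- Minimality of the conductor exponent: any trivialising exponent bounds it. [cite: TateThesis1967, §2.3] -/
theorem conductorExponentAt_le_of_isTrivialOnHigherUnitsAt {χ : HeckeCharacter K} {v : HeightOneSpectrum (𝓞 K)} {f : ℕ}
    (h : χ.IsTrivialOnHigherUnitsAt v f) : χ.conductorExponentAt v ≤ f :=
  Nat.sInf_le h

/-- `0 < f(χ_v) ⟺ χ` is ramified at `v`. [cite: LiXu2026, §2.1.1 (arXiv:2502.12648)] -/
theorem conductorExponentAt_pos_iff (χ : HeckeCharacter K) (v : HeightOneSpectrum (𝓞 K)) :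
    0 < χ.conductorExponentAt v ↔ ¬ χ.IsUnramifiedAt v := by
  rw [pos_iff_ne_zero, Ne, conductorExponentAt_eq_zero_iff]

/-- **Lowering the exponents of a module of definition.**  If `(T, e)` is a module of definition of `χ` and `χ_v` is
trivial on `U_v^{(f_v)}` for every `v ∈ T`, then `(T, f)` is a module of definition: a test idele `x` of `(T, f)` factors as
`(x · ∏_{v∈T} ⟨x_v⟩_v⁻¹) · ∏_{v∈T} ⟨x_v⟩_v`, the first factor being `1` at `T` (so killed by `(T, e)`), the second a product of
local units in the `U_v^{(f_v)}`. [cite: NeukirchANT1999, Ch. VII §6 (6.10)–(6.11)] -/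
theorem IsModulus.of_isTrivialOnHigherUnitsAt {χ : HeckeCharacter K} {T : Finset (HeightOneSpectrum (𝓞 K))}
    {e f : HeightOneSpectrum (𝓞 K) → ℕ} (hmod : χ.IsModulus T e)
    (hf : ∀ v ∈ T, χ.IsTrivialOnHigherUnitsAt v (f v)) : χ.IsModulus T f := by
  intro x h1 h2 h3
  -- the components of `x` as units of the local rings of integers
  have hmem : ∀ v : HeightOneSpectrum (𝓞 K), (x : AdeleRing (𝓞 K) K).2 v ∈ v.adicCompletionIntegers K := fun v => by
    rw [HeightOneSpectrum.mem_adicCompletionIntegers]; exact (h2 v).le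
  have hau : ∀ v : HeightOneSpectrum (𝓞 K), IsUnit (⟨(x : AdeleRing (𝓞 K) K).2 v, hmem v⟩ : v.adicCompletionIntegers K) :=
    fun v => HeightOneSpectrum.adicCompletionIntegers.isUnit_iff_valued_eq_one.2 (h2 v)
  set u : ∀ v : HeightOneSpectrum (𝓞 K), (v.adicCompletion K)ˣ :=
    fun v => Units.map ((v.adicCompletionIntegers K).subtype : _ →* _) (hau v).unit with hu
  have huval : ∀ v : HeightOneSpectrum (𝓞 K), ((u v : (v.adicCompletion K)ˣ) : v.adicCompletion K) = (x : AdeleRing (𝓞 K) K).2 v :=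
    fun v => rfl
  set G : ideleGroup K := ∏ v ∈ T, localUnits v (u v) with hG
  -- the local unit factors are killed by the place-wise triviality
  have hGχ : χ G = 1 := by
    rw [hG, map_prod]
    refine Finset.prod_eq_one fun v hv => ?_
    have h := hf v hv (hau v).unit (by simpa using h3 v hv)
    rwa [localComponent_apply] at h
  -- the complementary factor is `1` at `T` and passes the `(T, e)` test
  have hy : χ (x * G⁻¹) = 1 := by
    refine hmod _ ?_ (fun w => ?_) (fun w hw => ?_)
    · rw [ideleGroup_val_fst_mul, h1, one_mul]
      have h := ideleGroup_val_inv_fst_mul G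
      rwa [hG, fst_prod_localUnits, mul_one] at h
    · rw [ideleGroup_val_snd_mul, ideleGroup_val_inv_snd, hG, snd_prod_localUnits]
      split_ifs with hw
      · rw [huval, mul_inv_cancel₀ (ideleGroup_snd_ne_zero x w), map_one]
      · rw [inv_one, mul_one]; exact h2 w
    · rw [ideleGroup_val_snd_mul, ideleGroup_val_inv_snd, hG, snd_prod_localUnits, if_pos hw, huval,
        mul_inv_cancel₀ (ideleGroup_snd_ne_zero x w), sub_self, map_zero]
      exact zero_le
  have hx : χ x = χ (x * G⁻¹) * χ G := by rw [map_mul, map_inv, inv_mul_cancel_right]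
  rw [hx, hy, hGχ, one_mul]

/-- ★ **The conductor is a module of definition**: `χ` kills every idele `x` with `x_∞ = 1`, unit components, and
`x_v ≡ 1 mod 𝔭_v^{f(χ_v)}` at the ramified places (Neukirch VII §6, after (6.11): the conductor is the smallest module of
definition). [cite: NeukirchANT1999, Ch. VII §6 (6.11)] -/
theorem isModulus_conductorExponentAt (χ : HeckeCharacter K) :
    χ.IsModulus (finite_ramifiedPlaces_holds χ).toFinset (fun v => χ.conductorExponentAt v) := by
  obtain ⟨e, hmod⟩ := χ.exists_isModulus_of_ramified
  exact hmod.of_isTrivialOnHigherUnitsAt fun v _ => isTrivialOnHigherUnitsAt_conductorExponentAt χ v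

/-- Membership in the ramified set `ram χ` (as a `Finset`): the support of the finite part of the conductor (Neukirch VII (6.11)).
[cite: NeukirchANT1999, Ch. VII §6 (6.11)] -/
theorem mem_toFinset_ramifiedPlaces_iff (χ : HeckeCharacter K) (v : HeightOneSpectrum (𝓞 K)) :
    v ∈ (finite_ramifiedPlaces_holds χ).toFinset ↔ ¬ χ.IsUnramifiedAt v := by
  rw [Set.Finite.mem_toFinset]; rfl

/-- At a ramified place the conductor exponent is positive. [cite: LiXu2026, §2.1.1 (arXiv:2502.12648)] -/
theorem conductorExponentAt_pos_of_mem_toFinset (χ : HeckeCharacter K) {v : HeightOneSpectrum (𝓞 K)}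
    (hv : v ∈ (finite_ramifiedPlaces_holds χ).toFinset) : 0 < χ.conductorExponentAt v :=
  (χ.conductorExponentAt_pos_iff v).mpr ((χ.mem_toFinset_ramifiedPlaces_iff v).mp hv)

/-! ### §3 The ray relation modulo the SHARP modulus `∏_{v∈T} 𝔭_v^{e_v}` -/

/-- ★★ **The Größencharakter of an algebraic Hecke character on the ray modulo the SHARP modulus.**  Let `χ` have module of
definition `(T, e)` with `e_v ≥ 1` for `v ∈ T`, put `𝔣 = ∏_{v ∈ T} 𝔭_v^{e_v}`, let `χ` have infinity type `(p, q)`, and let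
`χ̃(𝔞) = ∏_𝔭 χ(ϖ_𝔭)^{v_𝔭(𝔞)}`.  For nonzero integers `b, c` with `c` prime to `𝔣`, `b ≡ c mod 𝔣` and `b/c` totally positive,
`χ̃((b)) = χ̃((c)) · ∏_w σ_w(b/c)^{p_w} \overline{σ_w(b/c)}^{q_w}`.  Proof: Neukirch's decomposition of the principal ideles `b`, `c`
(VII (6.13), `map_principalIdele_eq`): at `v ∈ T`, `b/c ∈ U_v^{(e_v)}` (valuation of `b − c` at least `e_v`, `c` a unit), so the local factors
at `T` agree; off `T` the local values are `χ(ϖ_𝔭)^{v_𝔭}`; the infinite parts differ by `A_{p,q}((b/c)_∞)`.  Same argument as the tree's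
`idealPow_span_eq` (modulus `∏ 𝔭_v^{e_v+1}`), without the slack exponent.
[cite: NeukirchANT1999, Ch. VII §6 Prop. (6.13) and Cor. (6.14)] [cite: Weil1956, §1] -/
theorem HasInfinityType.idealPow_span_eq_sharp {χ : HeckeCharacter K} {p q : InfinitePlace K → ℤ}
    (hinf : χ.HasInfinityType p q) {T : Finset (HeightOneSpectrum (𝓞 K))}
    {e : HeightOneSpectrum (𝓞 K) → ℕ} (hmod : IsModulus χ T e) (he : ∀ v ∈ T, 0 < e v) {b c : 𝓞 K} (hb : b ≠ 0) (hc : c ≠ 0)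
    (hcop : IsCoprime (Ideal.span {c}) (∏ v ∈ T, v.asIdeal ^ e v)) (hbc : b - c ∈ ∏ v ∈ T, v.asIdeal ^ e v)
    (hpos : ∀ φ : K →+* ℝ, 0 < φ b * φ c) :
    LFunctions.idealPow K (fun v => χ.valueAtUniformizer v) (Ideal.span {b}) =
      LFunctions.idealPow K (fun v => χ.valueAtUniformizer v) (Ideal.span {c}) *
        ∏ w : InfinitePlace K, w.embedding ((b : K) / c) ^ (p w) * conj (w.embedding ((b : K) / c)) ^ (q w) := by
  set 𝔣 : Ideal (𝓞 K) := ∏ v ∈ T, v.asIdeal ^ e v with h𝔣def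
  have h𝔣0 : 𝔣 ≠ ⊥ := prod_pow_asIdeal_ne_bot T e
  have hb' : (b : K) ≠ 0 := fun h => hb (by exact_mod_cast h)
  have hc' : (c : K) ≠ 0 := fun h => hc (by exact_mod_cast h)
  set bu : Kˣ := Units.mk0 (b : K) hb' with hbu
  set cu : Kˣ := Units.mk0 (c : K) hc' with hcu
  have hbcop : IsCoprime (Ideal.span {b}) 𝔣 := LFunctions.isCoprime_span_of_sub_mem hcop hbc
  have hcT : ∀ v ∈ T, c ∉ v.asIdeal := fun v hv hcv =>
    (LFunctions.isCoprime_iff_forall_not_le h𝔣0).mp hcop v ((prod_pow_asIdeal_le_iff he).mpr hv)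
      ((Ideal.span_singleton_le_iff_mem _).mpr hcv)
  have hbT : ∀ v ∈ T, b ∉ v.asIdeal := fun v hv hbv =>
    (LFunctions.isCoprime_iff_forall_not_le h𝔣0).mp hbcop v ((prod_pow_asIdeal_le_iff he).mpr hv)
      ((Ideal.span_singleton_le_iff_mem _).mpr hbv)
  have hvalb : ∀ v ∈ T, v.valuation K (b : K) = 1 := fun v hv =>
    (HeightOneSpectrum.valuation_eq_one_iff_notMem (K := K) v).mpr (hbT v hv)
  have hvalc : ∀ v ∈ T, v.valuation K (c : K) = 1 := fun v hv =>
    (HeightOneSpectrum.valuation_eq_one_iff_notMem (K := K) v).mpr (hcT v hv)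
  -- the finite set `S ⊇ T` outside which `b` and `c` are units
  set S : Finset (HeightOneSpectrum (𝓞 K)) :=
    T ∪ (finite_setOf_valuation_coe_ne_one (K := K) hb).toFinset ∪
      (finite_setOf_valuation_coe_ne_one (K := K) hc).toFinset with hSdef
  have hTS : T ⊆ S := Finset.subset_union_left.trans Finset.subset_union_left
  have hSb : ∀ v ∉ S, v.valuation K (b : K) = 1 := fun v hv => by
    by_contra h
    exact hv (Finset.mem_union_left _ (Finset.mem_union_right _ ((Set.Finite.mem_toFinset _).mpr h)))
  have hSc : ∀ v ∉ S, v.valuation K (c : K) = 1 := fun v hv => by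
    by_contra h
    exact hv (Finset.mem_union_right _ ((Set.Finite.mem_toFinset _).mpr h))
  -- Neukirch's decomposition for `b` and `c`
  have hB := map_principalIdele_eq hmod bu hTS hSb
  have hC := map_principalIdele_eq hmod cu hTS hSc
  -- the infinite parts differ by the archimedean factor of `b/c`
  set A : ℂ := ∏ w : InfinitePlace K, w.embedding ((b : K) / c) ^ (-p w) * conj (w.embedding ((b : K) / c)) ^ (-q w)
    with hA
  have hbcval : ((bu * cu⁻¹ : Kˣ) : K) = (b : K) / c := by
    rw [Units.val_mul, Units.val_inv_eq_inv_val, hbu, hcu, Units.val_mk0, Units.val_mk0, div_eq_mul_inv]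
  have hposq : ∀ φ : K →+* ℝ, 0 < φ ((bu * cu⁻¹ : Kˣ) : K) := fun φ => by
    rw [hbcval]; exact pos_div_of_mul_pos hc' φ (hpos φ)
  have hinfq : (χ (infiniteIdeles K (globalToInfiniteUnits K (bu * cu⁻¹))) : ℂ) = A := by
    rw [hinf.apply_globalToInfiniteUnits_eq hposq, hA]
    simp only [hbcval]
  have hA0 : A ≠ 0 := by rw [← hinfq]; exact Units.ne_zero _
  have hIb : χ (infiniteIdeles K (globalToInfiniteUnits K bu)) =
      χ (infiniteIdeles K (globalToInfiniteUnits K cu)) * χ (infiniteIdeles K (globalToInfiniteUnits K (bu * cu⁻¹))) := by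
    rw [map_mul, map_inv, map_mul, map_inv, map_mul, map_inv, mul_comm, inv_mul_cancel_right]
  -- the parts at `T` agree: `b/c ∈ U_v^{(e_v)}`
  have hTpart : ∏ v ∈ T, χ (localUnits v (globalToLocalUnits v bu)) =
      ∏ v ∈ T, χ (localUnits v (globalToLocalUnits v cu)) := by
    have h1 := map_prod_localUnits_eq_one_of_isModulus hmod
      (fun v => globalToLocalUnits v bu * (globalToLocalUnits v cu)⁻¹) (fun v hv => ?_) (fun v hv => ?_)
    · simp only [map_mul, map_inv, Finset.prod_mul_distrib, Finset.prod_inv_distrib,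
        mul_inv_eq_one, map_prod] at h1
      exact h1
    · rw [Units.val_mul, Units.val_inv_eq_inv_val, map_mul, map_inv₀, val_globalToLocalUnits,
        val_globalToLocalUnits, valued_algebraMap_adicCompletion, valued_algebraMap_adicCompletion,
        hbu, hcu, Units.val_mk0, Units.val_mk0, hvalb v hv, hvalc v hv, inv_one, mul_one]
    · have hcv : Valued.v (algebraMap K (v.adicCompletion K) (c : K)) = 1 := by
        rw [valued_algebraMap_adicCompletion]; exact hvalc v hv
      have hc0 : algebraMap K (v.adicCompletion K) (c : K) ≠ 0 := (map_ne_zero _).2 hc'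
      have heq : ((globalToLocalUnits v bu * (globalToLocalUnits v cu)⁻¹ : (v.adicCompletion K)ˣ) :
          v.adicCompletion K) - 1 =
          (algebraMap K (v.adicCompletion K) (b : K) - algebraMap K (v.adicCompletion K) (c : K)) *
            (algebraMap K (v.adicCompletion K) (c : K))⁻¹ := by
        rw [Units.val_mul, Units.val_inv_eq_inv_val, val_globalToLocalUnits, val_globalToLocalUnits,
          hbu, hcu, Units.val_mk0, Units.val_mk0, sub_mul, mul_inv_cancel₀ hc0]
      have hcast : (b : K) - (c : K) = algebraMap (𝓞 K) K (b - c) := by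
        rw [map_sub]
      rw [heq, map_mul, map_inv₀, hcv, inv_one, mul_one, ← map_sub, valued_algebraMap_adicCompletion,
        hcast, HeightOneSpectrum.valuation_of_algebraMap]
      have hmem : b - c ∈ v.asIdeal ^ e v := Ideal.le_of_dvd (pow_dvd_prod_pow_asIdeal e hv) hbc
      exact (HeightOneSpectrum.intValuation_le_pow_iff_mem v (b - c) (e v)).mpr hmem
  -- translate the local values off `T` into powers of `χ(ϖ_v)`
  have hval : ∀ {d : 𝓞 K} (hd : d ≠ 0) (du : Kˣ) (hdu : (du : K) = d), ∀ v ∈ S \ T,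
      (χ (localUnits v (globalToLocalUnits v du)) : ℂ) =
        χ.valueAtUniformizer v ^ (Associates.mk v.asIdeal).count
          (Associates.mk (Ideal.span {d} : Ideal (𝓞 K))).factors := by
    intro d hd du hdu v hv
    have hvT : v ∉ T := (Finset.mem_sdiff.mp hv).2
    rw [(isUnramifiedAt_of_isModulus' hmod hvT).coe_map_localUnits_eq_zpow (globalToLocalUnits v du)
      (m := ((Associates.mk v.asIdeal).count (Associates.mk (Ideal.span {d} : Ideal (𝓞 K))).factors : ℤ))
      (by rw [val_globalToLocalUnits, hdu]; exact valued_coe_ringOfIntegers v hd), zpow_natCast]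
  have hprod : ∀ {d : 𝓞 K} (hd : d ≠ 0) (du : Kˣ) (hdu : (du : K) = d)
      (hdT : ∀ v ∈ T, d ∉ v.asIdeal) (hdS : ∀ v ∉ S, v.valuation K (d : K) = 1),
      LFunctions.idealPow K (fun v => χ.valueAtUniformizer v) (Ideal.span {d}) =
        ((∏ v ∈ S \ T, χ (localUnits v (globalToLocalUnits v du)) : ℂˣ) : ℂ) := by
    intro d hd du hdu hdT hdS
    rw [Units.coe_prod, LFunctions.idealPow, finprod_eq_prod_of_mulSupport_subset _ (s := S \ T) ?_]
    · exact Finset.prod_congr rfl fun v hv => (hval hd du hdu v hv).symm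
    · intro v hv
      rw [Function.mem_mulSupport] at hv
      have hcnt : (Associates.mk v.asIdeal).count
          (Associates.mk (Ideal.span {d} : Ideal (𝓞 K))).factors ≠ 0 := fun h0 => hv (by rw [h0, pow_zero])
      have hdvd : v.asIdeal ∣ Ideal.span {d} :=
        (Associates.count_ne_zero_iff_dvd ((Submodule.ne_bot_iff _).mpr
          ⟨d, Ideal.mem_span_singleton_self d, hd⟩) v.irreducible).mp hcnt
      have hdv : d ∈ v.asIdeal := Ideal.dvd_span_singleton.mp hdvd
      rw [Finset.coe_sdiff, Set.mem_sdiff, Finset.mem_coe, Finset.mem_coe]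
      refine ⟨?_, fun hvT => hdT v hvT hdv⟩
      by_contra hvS
      have := hdS v hvS
      rw [HeightOneSpectrum.valuation_eq_one_iff_notMem (K := K) v] at this
      exact this hdv
  -- the algebra, in `ℂ`
  rw [← Finset.prod_sdiff hTS, hTpart, hIb] at hB
  rw [← Finset.prod_sdiff hTS] at hC
  have h1 := congrArg Units.val hB
  have h2 := congrArg Units.val hC
  simp only [Units.val_mul, Units.val_one] at h1 h2
  rw [hinfq] at h1
  set Ic : ℂ := (χ (infiniteIdeles K (globalToInfiniteUnits K cu)) : ℂ) with hIc
  set Pb : ℂ := ((∏ v ∈ S \ T, χ (localUnits v (globalToLocalUnits v bu)) : ℂˣ) : ℂ) with hPb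
  set Pc : ℂ := ((∏ v ∈ S \ T, χ (localUnits v (globalToLocalUnits v cu)) : ℂˣ) : ℂ) with hPc
  set PT : ℂ := ((∏ v ∈ T, χ (localUnits v (globalToLocalUnits v cu)) : ℂˣ) : ℂ) with hPT
  have hIc0 : Ic ≠ 0 := Units.ne_zero _
  have hPT0 : PT ≠ 0 := Units.ne_zero _
  have key : (Pb * A - Pc) * (Ic * PT) = 0 := by linear_combination h1 - h2
  have hPbA : Pb * A = Pc := by
    have := mul_eq_zero.mp key
    rcases this with h | h
    · exact sub_eq_zero.mp h
    · exact absurd h (mul_ne_zero hIc0 hPT0)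
  have hinvA : A⁻¹ = ∏ w : InfinitePlace K, w.embedding ((b : K) / c) ^ (p w) * conj (w.embedding ((b : K) / c)) ^ (q w) := by
    rw [hA, ← Finset.prod_inv_distrib]
    refine Finset.prod_congr rfl fun w _ => ?_
    rw [mul_inv, zpow_neg, zpow_neg, inv_inv, inv_inv]
  rw [hprod hb bu rfl hbT hSb, hprod hc cu rfl hcT hSc, ← hinvA, ← hPb, ← hPc, ← hPbA,
    mul_inv_cancel_right₀ hA0]

/-- **The ideal character `v ↦ χ(ϖ_v)` of an algebraic Hecke character of type `(p, q)` is a Größencharakter modulo the SHARP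
modulus `∏_{v∈T} 𝔭_v^{e_v}`** of any module of definition `(T, e)` with `e ≥ 1` on `T` (Neukirch VII (6.13)–(6.14); the values
`χ(ϖ_v) ∈ ℂˣ` are never zero). [cite: NeukirchANT1999, Ch. VII §6 Prop. (6.13) and Cor. (6.14)] -/
theorem isGrossencharakter_valueAtUniformizer_sharp {χ : HeckeCharacter K} {p q : InfinitePlace K → ℤ}
    (hinf : χ.HasInfinityType p q) {T : Finset (HeightOneSpectrum (𝓞 K))} {e : HeightOneSpectrum (𝓞 K) → ℕ}
    (hmod : χ.IsModulus T e) (he : ∀ v ∈ T, 0 < e v) :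
    IsGrossencharakter (∏ v ∈ T, v.asIdeal ^ e v) p q (fun v => χ.valueAtUniformizer v) := by
  refine ⟨fun v _ => ?_, fun b c hb hc hcop hbc hpos => hinf.idealPow_span_eq_sharp hmod he hb hc hcop hbc hpos⟩
  simp only [HeckeCharacter.valueAtUniformizer]
  exact Units.ne_zero _

/-- ★ **The ideal character of an algebraic Hecke character is a Größencharakter modulo its CONDUCTOR** `∏_{v ∈ ram χ} 𝔭_v^{f(χ_v)}`
(Neukirch VII §6: the conductor is a module of definition, (6.11); (6.13)–(6.14)). [cite: NeukirchANT1999, Ch. VII §6 (6.11), Prop. (6.13), Cor. (6.14)] -/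
theorem isGrossencharakter_valueAtUniformizer_conductor {χ : HeckeCharacter K} {p q : InfinitePlace K → ℤ}
    (hinf : χ.HasInfinityType p q) :
    IsGrossencharakter (∏ v ∈ (finite_ramifiedPlaces_holds χ).toFinset, v.asIdeal ^ χ.conductorExponentAt v) p q
      (fun v => χ.valueAtUniformizer v) :=
  isGrossencharakter_valueAtUniformizer_sharp hinf χ.isModulus_conductorExponentAt
    fun _ hv => χ.conductorExponentAt_pos_of_mem_toFinset hv

end HeckeCharacter

end Literature.NumberTheory.GaloisRepresentations

end
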